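import Mathlib
import HarnessLib
import HarnessLib.Audit
import Summits.AtomisticToContinuum.Statement
import Summits.AtomisticToContinuum.FouriersLaw.Theorems.EmbeddedDrudeMourreNessUnique
import Summits.AtomisticToContinuum.FouriersLaw.Theorems.FourierGreenKuboFourierFiniteResponseOfUnique

/-!
Route: SpatialSlowManifold

CLOSED (retired) 2026-08-15T13:46:44Z by operator:999:1257524 — reason: not-a-thesis: assembly does not conclude the sub-problem Statement — note: D-0027 §2.1 audit (human 2026-08-15: routes that do not decide the summit are removed): the assembly concludes `Literature.MathematicalPhysics.KineticTheory.HeatConduction.FouriersLaw`, not the sub-problem statement; a NEW conforming route may be opened from the same idea (generated `closes : … → _r. The file is kept as the record of this route; refuted decls are indexed as negative knowledge (`ledger negatives`).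

X (SPATIAL SLOW MANIFOLD — "Kirchgässner in space"; realises idea card
AtomisticToContinuum/FouriersLaw/spatial-dynamics-slow-manifold).
For pinnedChain ω₂ lam β γ (all four > 0) and T > 0, treat the SITE INDEX as time. Since V′(r) = r +
βr³ is a bijection, Newton's
equation at an interior site solved for the next site, q_{i+1} = q_i + (V′)⁻¹(q̈_i + U′(q_i) +
V′(q_i − q_{i−1})), defines a
deterministic spatial shift 𝒮 on pairs of site-paths and a transfer map 𝒮_* on time-stationary
pair-path LAWS; the equilibrium
pair-path laws {G_T} (adjacent sites of the stationary infinite Gibbs process) are a curve of fixed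
points, the bond current J is an
exact invariant, and the two Langevin relations are boundary conditions at i = 0 and i = N−1: the
N-site NESS is a two-point
boundary-value problem of duration N for 𝒮_*. BET (upper layer, informal until the objects are
defined — definition requests filed):
 U1 SpatialSpectralGap: d𝒮_*|_{G_T} is hyperbolic on tempered stationary pair-path laws except for a
two-dimensional centre at 1
    (Jordan block: ∂_T G_T and a current-carrying direction — J shifts T), exactly as the double
eigenvalue 0 + first integral of
    Iooss–Kirchgässner's spatial dynamics for FPU travelling waves (HaragusIooss2011 §5.2.3);
 U2 SlowManifoldBVP: a normally hyperbolic 2-D slow manifold {G_{T,J}} persists, carrying the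
reduced map (T, J) ↦ (T − r(T)J + O(J²), J)
    — the DISCRETE FOURIER LAW, κ = 1/r — and the NESS tracks it, every transverse direction being a
geometric boundary layer at a
    bath (= the contact temperature jumps); r and the layer rate θ are read off the bath-free
equilibrium transfer.
TYPED CONTENT (what U1–U2 deliver at finite N, first order in δT, in the Statement's own vocabulary;
all under weak-NESS uniqueness):
 (a) LocalFourierLaw: the linear-response kinetic-temperature profile τ_N(i) = lim_δ
(μ_{N,T+δ/2,T−δ/2}(p_i²) − T)/δ and current
     ι_N = lim_δ J/δ exist and |τ_N(i+1) − τ_N(i) + r ι_N| ≤ C|ι_N|(θ^i + θ^{N−2−i}), 0 ≤ θ < 1, r >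
0, uniformly in N;
 (b) ExpAffineResistance: R_N := (N−1)/D_N satisfies |R_N − (N−1)r − c| ≤ Cθ^N;
 (c) BathIndependentResistivity: one r = r(ω₂, lam, β, T) serves every bath coupling γ > 0 in |R_N −
(N−1)r| ≤ C(γ);
 (d) AffineResistanceLaw: |R_N − (N−1)r| ≤ C (implied by (a)+BathFluxBalance, by (b), and by (c);
the assembly's input);
 with (e) NessUnique and (f) FiniteResponseOfUnique (shared with route FourierGreenKubo) this yields
FouriersLawFor (pinnedChain ω₂ lam β γ)
 with κ(T) = 1/r(T) and the finite-size law D_N = κ + O(1/N), hence FouriersLaw.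
X := LocalFourierLaw ∧ ExpAffineResistance ∧ BathIndependentResistivity ∧ AffineResistanceLaw ∧
NessUnique ∧ FiniteResponseOfUnique
(each conjunct its own item, filed EXPANDED; no separate Target item, to respect the one-line
signature cap).
Lean: `LocalFourierLaw ∧ BathIndependentResistivity ∧ ExpAffineResistance ∧ AffineResistanceLaw ∧
NessUnique ∧ FiniteResponseOfUnique` (decls of this route file, namespace
Summit.AtomisticToContinuum.FouriersLaw.Theses.SpatialSlowManifold; planner Sketch.lean rc 0)
Lean shape of the assembly (planner sketch rc 0; `example : Assembly = (NessUnique →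
FiniteResponseOfUnique → AffineResistanceLaw →
Literature.MathematicalPhysics.KineticTheory.HeatConduction.FouriersLaw) := rfl`): κ T := 1/r(T)
from AffineResistanceLaw (T > 0, else 1);
|1/D_N − r| ≤ C/(N−1) forces D_N ≠ 0 eventually and D_N → 1/r; clause (i) from the PROVED fact
Literature.MathematicalPhysics.KineticTheory.HeatConduction.CuneoEckmannHairerReyBellet2018_pinnedChain_holds
+ OscillatorChain.isSteadyState_zero + NessUnique.

Rationale: WHY THIS LINE. BLR's limit (33) is "N iterations of something": every interior site of a stationary
chain is obtained from its two
left neighbours by the same N-independent rule (Newton's equation solved for q_{i+1}; V′ bijective),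
so N → ∞ becomes long-time behaviour
of ONE map 𝒮_* on stationary pair-path laws near its fixed-point curve {G_T} with one conserved
quantity J. This imports DYNAMICAL-SYSTEMS
structure — Kirchgässner's spatial dynamics and centre-manifold reduction for lattices
(Kirchgassner1982, IoossKirchgassner2000, James2003,
HaragusIooss2011 §5.2.3: for FPU waves 0 is a double eigenvalue of L_τ because of the 2-parameter
family of stretched lattices plus a first
integral — verbatim the (T, J) block), normal hyperbolicity / invariant manifolds in Banach space
(BatesLuZeng1998), anisotropic spaces for
transfer operators of hyperbolic maps (GouezelLiverani2005) — with an explicit dictionary: unbounded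
coordinate ξ ↦ site i; elliptic cylinder
equation ↦ Newton solved for the next site; cross-section space ↦ tempered stationary pair-path
laws; bounded solutions on long cylinders ↦ NESS
of long chains; finite-dimensional centre (ellipticity) ↦ 2-D thermodynamic centre (anharmonic
dephasing: THE bet); reduced ODE ↦
T_{i+1} − T_i = −r(T_i)J. At kinetic level this is Milne/Chapman–Enskog layer theory
(BardosCaflischNicolaenko1986, CoronGolseSulem1988), lifted
to the microscopic transfer map; it EXPLAINS the phenomenology — contact jumps ∝ J and κ_N = κ/(1 +
ℓ/N) (AokiKusnezov2001, AokiKusnezov2002,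
LepriLiviPoliti2003, Dhar2008) are the hyperbolic fibres and slow-manifold tracking; κ lives on the
centre manifold, γ only moves the boundary
manifolds. Versus the only open route FourierGreenKubo (temporal decay C_T ∈ L¹ + separate N → ∞,
exposed to Becker–Menegaki gap closing): the gap
here is SPATIAL and at equilibrium, and N → ∞, contact corrections and finite-size law come from one
normal form. Negatives index empty.
RANKED CRUXES. (typed, all elaborate in the planner sketch rc 0; why-might-fail + sources ride on
each item)
 #2 LocalFourierLaw — local Fourier law in linear response with GEOMETRIC contact layers, uniformly
in N (finite-N shadow of U1+U2; attackable now,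
    certified numerics can probe θ).
 #3 BathIndependentResistivity — the bulk resistivity r of the affine law does not depend on γ
(centre manifold = bath-free; refutable by two-γ
    numerics; unproved for every Hamiltonian chain, BonettoLebowitzReyBellet2000 §7).
 #4 ExpAffineResistance — |R_N − (N−1)r − c| ≤ Cθ^N (layers + exponentially small layer–layer
interaction; sharpest D_N-only fingerprint).
 #5 AffineResistanceLaw — |R_N − (N−1)r| ≤ C: Fourier + finite-size law D_N = κ + O(1/N); the
assembly's input, implied by #2 (+BathFluxBalance),
    by #3 and by #4 (sketch lemmas expAffine_imp_affine, bathIndependent_imp_affine proved).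
SUPPORT. BathFluxBalance (J = γ(T_L − ⟨p_0²⟩) = γ(⟨p_{N−1}²⟩ − T_R), equal bond currents, second
moments — from NessUnique + the PROVED CEHR2018 fact
+ Dynkin extension of ∫Lf dμ = 0 to polynomial f; provable now); LocalLawToResistance (#2 →
BathFluxBalance → #5; provable now); NessUnique,
FiniteResponseOfUnique (= FourierGreenKubo items 0741/0717, reattached by signature). Cone:
Statement vocabulary only; the one fact touched
(CuneoEckmannHairerReyBellet2018_pinnedChain) is proved. Assembly: NessUnique →
FiniteResponseOfUnique → AffineResistanceLaw → FouriersLaw (κ := 1/r).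
KILL CRITERIA. (i) a second local conserved charge of the infinite pinned chain (extra neutral
direction; Mazur) or κ = ∞ refutes #2, #4, #5 →
close refuted:AffineResistanceLaw; (ii) proof or certified numerics that R_N − (N−1)r drifts (log N,
N^α layers) at some admissible
(ω₂, lam, β, γ, T) refutes #5 (and #2, #4) while Fourier may survive → close, card outcome refuted;
(iii) γ-dependence of lim D_N refutes #3 →
mechanism dead: restate to a per-γ line or close; (iv) the calibration in CHEAPEST FALSIFIER failing
⇒ U1's 'exactly two neutral directions' is
wrong ⇒ close unless #2 survives numerically with power-law layers (then restate #2/#4 with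
polynomial tracking).
NOT DECOMPOSED YET. The upper layer: the Banach-manifold setting (anisotropic norms pairing
forward/backward recursions — 𝒮_* is a pushforward
by an invertible map, so a gap exists only on adapted spaces), U1 SpatialSpectralGap, U2
SlowManifoldBVP and the glue
U2 → LocalFourierLaw ∧ ExpAffineResistance ∧ BathIndependentResistivity; 'BVP solution = NESS pair
marginals'; r = 1/κ_GK; T-continuity of r.
They become typed cruxes by `route edit` when the definitions land; foreseen layer-2 split of #2:
SpatialSpectralGap → SlowManifoldBVP → #2.
CHEAPEST FALSIFIER. Linear algebra, no dynamics: for the solvable harmonic chain with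
self-consistent reservoirs (BonettoLebowitzLukkarinen2004 —
Fourier's law holds, exactly linear profile) write the zero-frequency spatial transfer of the
stationary covariances (Gaussian; 4×4 per frequency)
and count unimodular directions: exactly two = calibration passed; more = the heuristic behind U1 is
wrong. Next cheapest: NESS numerics on
pinnedChain (all parameters 1, T = 1, N = 8…128): residuals of R_N against (N−1)r + c must decay
geometrically and the contact-layer profile like
θ^i; repeat at γ = 0.2 and 5 for the slope. Not run here (compute-free hub, plancard seat) — first
refuter task.
DEFINITION REQUESTS. OscillatorChain.spatialShift (deterministic site-to-site map on pairs of C²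
paths, Mathlib-only) and
OscillatorChain.equilibriumPairPathLaw (G_T: adjacent-pair path law of the stationary infinite Gibbs
process; needs InfiniteChainDynamics) — filed
after open, topic Literature/MathematicalPhysics/KineticTheory. Further sources:
RiederLebowitzLieb1967, CasherLebowitz1971, AjankiHuveneers2011,
EckmannYoung2004, EckmannYoung2005, BricmontKupiainen2007, LefevereSchenkel2006,
BonettoLebowitzReyBellet2000 §5.3, §7.

Novelty: NOVELTY (plancard pass 2026-08-15; searches run: `lit search --hybrid "spatial dynamics center
manifold reduction lattice Iooss Kirchgassner
travelling waves Fermi-Pasta-Ulam"` (→ HaragusIooss2011 held, pp.275-277 read), `lit search --source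
crossref` ×2 (Aoki–Kusnezov boundary jumps /
φ⁴ NESS), `lit vsearch` on "bulk local equilibrium (T,J) + exponential boundary layers + contact
resistance" (textbooks only), `lit galaxy search
--star all` ×2 substring (0 rows) + `--star pdf --mode bm25` (engineering interface-resistance hits
only), `lit frontier AtomisticToContinuum
--since 2020`, `lit bridges AtomisticToContinuum --cross any`, `lit read` doi:10.1002/cpa.3160390304
and doi:10.1002/cpa.3160410403
(paywalled → acq-02139, acq-02145), `lean search` for self-consistent-reservoir vocabulary (none),
the card's own crossref/hybrid searches and
the refuter novelty audit of the card).
Nearest prior art, by ingredient: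
- STRUCTURE "2-D slow subspace of the spatial evolution + exponentially decaying layers" =
stationary kinetic boundary-layer (Milne/Kramers,
  Chapman–Enskog) theory where x IS time for μ∂_x f = Lf: BardosCaflischNicolaenko1986 (exponential
approach to the slow state),
  CoronGolseSulem1988 (well-posed layer problems classified by the neutral collision-invariant
subspace); for phonons = temperature-jump theory.
- TECHNIQUE spatial dynamics / centre manifolds for lattices: Kirchgassner1982,
IoossKirchgassner2000 (FPU travelling waves: "0 is always an
  eigenvalue of L_τ,  [refs: 10.1002/cpa.3160390304, 10.1002/cpa.3160410403, 10.1007/s002200050821, 10.1007/s00332-002-0525-x, 10.1103/physrevlett.86.4029, doi:10.1002/cpa.3160390304, doi:10.1002/cpa.3160410403, doi:10.1007/s002200050821, doi:10.1007/s00332-002-0525-x, doi:10.1103/physrevlett.86.4029, HaragusIooss2011, BardosCaflischNicolaenko1986, CoronGolseSulem1988, Kirchgassner1982, IoossKirchgassner2000, James2003, Riede]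

Barriers (technique_class: spatial-dynamics centre-manifold normal-hyperbolicity): - technique_class: spatial-dynamics centre-manifold normal-hyperbolicity
- Literature.Barriers.AtomisticToContinuum.HasBoundedResponse: APPLIES in substance
(hasBoundedResponse_of_fouriersLawFor PROVED; every typed crux asserts N-UNIFORM r, θ, C — exactly
what fixed-N tools CEHR2018/Carmona2007/HairerMajda2009 cannot give). Evasion as designed: N is the
number of iterations of ONE N-independent object (the equilibrium transfer 𝒮_* and its
hyperbolicity, U1); normally hyperbolic BVP estimates are uniform in the time horizon; fixed-N
theory is used only where allowed (existence of the δ-limits). Not evaded until U1 is a theorem —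
this is the bet.
- Literature.Barriers.AtomisticToContinuum.BeckerMenegaki2022_gapClosing: EVADED by construction —
no temporal relaxation rate of the N-chain is used; the gap is SPATIAL (spectrum of d𝒮_*|_{G_T} off
the unit circle but for the 2-D centre), a property of the infinite equilibrium chain; the closing
temporal gap λ_S ≤ γ/N is consistent with, indeed expected from, the neutral direction J.
- Literature.Barriers.AtomisticToContinuum.equilibrium_rate_bound: same as the parent entry — no
N-uniform rate to equilibrium enters any item.
- Literature.Barriers.AtomisticToContinuum.Mazur1969_inequality: APPLIES, NOT evaded — an extensive
conserved charge of the infinite pinned chain, odd under p ↦ −p and overlapping J, is an extra exact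
invariant of 𝒮_*, hence an extra neutral direction: U1 false and LocalFourierLaw /
ExpAffineResistance / AffineRes

History (route lifecycle, newest last):
- 2026-08-15T13:46:44Z · CLOSED retired — not-a-thesis: assembly does not conclude the sub-problem Statement (operator:999:1257524)

sub-problem: FouriersLaw · status: closed(retired) · opened planner-plancard-AtomisticToContinuum-Fourier-c4ceefcf-0 2026-08-15T11:18:21Z · rev 0 · ledger route-AtomisticToContinuum-SpatialSlowManifold
GENERATED by the gate from the ledger (D-0016/17). Provers cite these decls: `theorem foo : Summit.AtomisticToContinuum.FouriersLaw.Theses.SpatialSlowManifold.<Decl> := …` in Summits/AtomisticToContinuum/FouriersLaw/Theorems/<Name>.lean.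
-/

namespace Summit.AtomisticToContinuum.FouriersLaw.Theses.SpatialSlowManifold

open scoped BigOperators Topology Manifold Classical MeasureTheory ProbabilityTheory Matrix InnerProductSpace ComplexConjugate ContinuousMap
open Filter Set Function TopologicalSpace MeasureTheory

attribute [summit_statement] _root_.FouriersLaw

/-- item stmt-AtomisticToContinuum-3475 · crux · rank 2 · closed · moot by None · by planner
why it might fail: Geometric layers need a true SPATIAL gap of the equilibrium transfer: the diffusive energy mode or thermalised breathers may leave only power-law relaxation to local equilibrium (θ→1 at low T); an extra conserved charge kills it (Mazur); false at lam=β=0 (D_N~N); τ-limits unproved.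
sources: AokiKusnezov2002 (φ⁴ chain: linear bulk profiles, boundary jumps ∝ J, finite-size κ), AokiKusnezov2001 (doi:10.1103/physrevlett.86.4029: boundary jumps, κ(N) scaling), EckmannYoung2005 (profiles from local rules), BricmontKupiainen2007 §1 (closure solved as a spatial BVP: local equilibrium + corrections), HaragusIooss2011 §5.2.3 pp.275-277 (spatial dynamics for lattices; double eigenvalue 0 + first integral = the (T,J) block), decl Literature.Barriers.AtomisticToContinuum.HarmonicChainBallisticFlux
[crux] LOCAL FOURIER LAW IN LINEAR RESPONSE WITH GEOMETRIC CONTACT LAYERS — the finite-N shadow of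
U1 SpatialSpectralGap + U2 SlowManifoldBVP (see thesis). For pinnedChain ω₂ lam β γ (all > 0),
assuming weak-NESS uniqueness, and T > 0: there are r > 0 (bulk resistivity per bond), 0 ≤ θ < 1
(layer rate) and C such that for every steady-state family μ and every N the linear-response current
ι_N (totalCurrent(μ_{N,T+δ/2,T−δ/2})/δ → (N−1)ι_N as δ → 0, δ ≠ 0) and the kinetic-temperature
response profile τ_N(i) = lim (μ_{N,T+δ/2,T−δ/2}(p_i²) − T)/δ exist and |τ_N(i+1) − τ_N(i) + r ι_N|
≤ C|ι_N|(θ^i + θ^{N−2−i}) for every bond (i, i+1). Reading: on the slow manifold T_{i+1} − T_i =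
−r(T_i)J exactly; the true pair-path laws deviate from it by transverse components of size O(J)
excited at the two baths (at J = 0 the bath state is exactly G_T) and contracting geometrically
inwards along the stable/unstable fibres, hence corrections ∝ |ι|·θ^{distance to the bath}; kinetic
temperature is a legitimate coordinate on the slow manifold to first order (p² even under momentum
reversal). Edge cases: N = 0 forces ι = 0, N = 1 has no bond; for each fixed N ≥ 2 the constraint is
finite (needs ι_N ≠ 0, t -/
@[route_item "route-AtomisticToContinuum-SpatialSlowManifold"]
def LocalFourierLaw : Prop :=
  ∀ ω₂ lam β γ : ℝ, 0 < ω₂ → 0 < lam → 0 < β → 0 < γ → (∀ (N : ℕ) (T_L T_R : ℝ), 0 < T_L → 0 < T_R → ∀ μ ν : MeasureTheory.Measure (Literature.MathematicalPhysics.KineticTheory.HeatConduction.PhaseSpace N), (Literature.MathematicalPhysics.KineticTheory.HeatConduction.pinnedChain ω₂ lam β γ).IsSteadyState N T_L T_R μ → (Literature.MathematicalPhysics.KineticTheory.HeatConduction.pinnedChain ω₂ lam β γ).IsSteadyState N T_L T_R ν → μ = ν) → ∀ T : ℝ, 0 < T → ∃ r : ℝ, 0 < r ∧ ∃ θ C :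 ℝ, 0 ≤ θ ∧ θ < 1 ∧ ∀ μ : (N : ℕ) → ℝ → ℝ → MeasureTheory.Measure (Literature.MathematicalPhysics.KineticTheory.HeatConduction.PhaseSpace N), (∀ (N : ℕ) (T_L T_R : ℝ), 0 < T_L → 0 < T_R → (Literature.MathematicalPhysics.KineticTheory.HeatConduction.pinnedChain ω₂ lam β γ).IsSteadyState N T_L T_R (μ N T_L T_R)) → ∀ N : ℕ, ∃ ι : ℝ, ∃ τ : Fin N → ℝ, Filter.Tendsto (fun δ : ℝ => (Literature.MathematicalPhysics.KineticTheory.HeatConduction.pinnedChain ω₂ lam β γ).totalCurrent (μ N (T + δ / 2) (T - δ / 2)) / δ) (nhdsWithin 0 {(0 : ℝ)}ᶜ) (nhds (((N : ℝ) - 1) * ι)) ∧ (∀ i : Fin N, Filter.Tendsto (fun δ : ℝ => ((∫ x, (x.2 i) ^ 2 ∂(μ N (T + δ / 2) (T - δ / 2))) - T) / δ) (nhdsWithin 0 {(0 : ℝ)}ᶜ) (nhds (τ i))) ∧ ∀ i j : Fin N, j.val = i.val + 1 → |τ j - τ i + r * ι| ≤ C * |ι| * (θ ^ i.val + θ ^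 (N - 1 - j.val))

/-- item stmt-AtomisticToContinuum-3476 · crux · rank 3 · closed · moot by None · by planner
why it might fail: Bath-independence of κ_BLR is unproved for every Hamiltonian chain ('not even clear how to prove κ = κ_GK', BLR §7) and finite-N data are γ-dependent; if N→∞ selects a γ-dependent bulk state (non-unique stationary closure, quasi-integrable windows) it fails while Fourier holds for each γ.
sources: BonettoLebowitzReyBellet2000 §7 (37) (κ vs κ_GK), Dhar2008 (arXiv:0808.3256) §2.2, §9(e), LepriLiviPoliti2003 (coupling to the baths, contact resistance), AokiKusnezov2001, decl Literature.Barriers.AtomisticToContinuum.HasBoundedResponse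
[crux] BATH-INDEPENDENT BULK RESISTIVITY. For ω₂, lam, β > 0 and T > 0 there is ONE r = r(ω₂, lam,
β, T) > 0 such that for EVERY bath coupling γ > 0 (weak-NESS uniqueness for pinnedChain ω₂ lam β γ
assumed) some C = C(γ) bounds |(N−1)/D_N − (N−1)r| ≤ C for every steady-state family, every sequence
D of finite-N response coefficients (D_N = lim_{δ→0,δ≠0} totalCurrent(μ_{N,T+δ/2,T−δ/2})/δ) and
every N — i.e. κ_BLR(T) = 1/r(T) does not depend on γ, only the contact correction does. Mechanism:
r is the coefficient of the reduced map (T, J) ↦ (T − r(T)J + O(J²), J) on the centre manifold of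
the BATH-FREE equilibrium transfer 𝒮_*; γ enters only through the boundary manifolds B_L, B_R. For
each γ it implies AffineResistanceLaw (planner sketch: bathIndependent_imp_affine, rc 0). Also
expected from κ = κ_GK (route FourierGreenKubo) but unproved for every Hamiltonian chain; finite-N
numerics are γ-dependent (contact resistance ~ 1/γ + layer term) — the claim is about the SLOPE in
N. N = 0, 1: D_N = 0 and the bound reads (N−1)r ≤ C. Kill test: two-γ certified numerics of R_N
slopes. Sources: BonettoLebowitzReyBellet2000 §7, Dhar2008 §2.2/§9(e), LepriLiviPoliti2003,
AokiKusnezov2001. -/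
@[route_item "route-AtomisticToContinuum-SpatialSlowManifold"]
def BathIndependentResistivity : Prop :=
  ∀ ω₂ lam β : ℝ, 0 < ω₂ → 0 < lam → 0 < β → ∀ T : ℝ, 0 < T → ∃ r : ℝ, 0 < r ∧ ∀ γ : ℝ, 0 < γ → (∀ (N : ℕ) (T_L T_R : ℝ), 0 < T_L → 0 < T_R → ∀ μ ν : MeasureTheory.Measure (Literature.MathematicalPhysics.KineticTheory.HeatConduction.PhaseSpace N), (Literature.MathematicalPhysics.KineticTheory.HeatConduction.pinnedChain ω₂ lam β γ).IsSteadyState N T_L T_R μ → (Literature.MathematicalPhysics.KineticTheory.HeatConduction.pinnedChain ω₂ lam β γ).IsSteadyState N T_L T_R ν → μ = ν) → ∃ C : ℝ, ∀ μ : (N : ℕ) → ℝ → ℝ → MeasureTheory.Measure (Literature.MathematicalPhysics.KineticTheory.HeatConduction.PhaseSpace N), (∀ (N : ℕ) (T_L T_R : ℝ), 0 < T_L → 0 < T_R → (Literature.MathematicalPhysics.KineticTheory.HeatConduction.pinnedChain ω₂ lam β γ).IsSteadyState N T_L T_R (μ N T_L T_R)) → ∀ D : ℕ → ℝ, (∀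 N : ℕ, Filter.Tendsto (fun δ : ℝ => (Literature.MathematicalPhysics.KineticTheory.HeatConduction.pinnedChain ω₂ lam β γ).totalCurrent (μ N (T + δ / 2) (T - δ / 2)) / δ) (nhdsWithin 0 {(0 : ℝ)}ᶜ) (nhds (D N))) → ∀ N : ℕ, |((N : ℝ) - 1) / D N - ((N : ℝ) - 1) * r| ≤ C

/-- item stmt-AtomisticToContinuum-3477 · crux · rank 4 · closed · moot by None · by planner
why it might fail: Needs geometric layers AND N-independent layer shape up to θ^N; a power-law stationary tail (diffusive mode leaking into the zero-frequency sector, low-T breathers) gives |R_N−(N−1)r−c| ~ N^{-a} instead; κ=∞/hidden charge kills r; false at lam=β=0; nothing N-uniform is known.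
sources: AokiKusnezov2001 (finite-size law κ(N) with boundary jumps), AokiKusnezov2002, BardosCaflischNicolaenko1986 (exponential Milne layers at kinetic level), CoronGolseSulem1988 (well-posed kinetic layer problems: neutral subspace + exponential decay), decl Literature.Barriers.AtomisticToContinuum.HasBoundedResponse, decl Literature.Barriers.AtomisticToContinuum.HarmonicChainBallisticFlux
[crux] EXPONENTIALLY ACCURATE AFFINE RESISTANCE LAW. For pinnedChain (all parameters > 0), weak-NESS
uniqueness, T > 0: ∃ r > 0, c, 0 ≤ θ < 1, C such that for every steady-state family and every
sequence D of finite-N response coefficients, |R_N − (N−1)r − c| ≤ Cθ^N for all N, where R_N :=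
(N−1)/D_N (= δT/J to first order, the total thermal resistance; Lean (↑N−1)/D N is junk-safe: D_N =
0 would violate the bound for large N). Mechanism: the BVP solution is, up to O(θ^N) (overlap of the
left stable and right unstable layers), the concatenation of two semi-infinite layer solutions glued
along the slow manifold, so R_N = (N−1)r + c_L(γ,T) + c_R(γ,T) + O(θ^N), with c ≈ 2/γ + layer terms
(T_L − ⟨p_0²⟩ = J/γ exactly). Gives the finite-size law D_N = κN/(N+ℓ) + O(θ^N), κ = 1/r, ℓ = c/r −
1 (Aoki–Kusnezov-type scaling). Implies AffineResistanceLaw (planner sketch: expAffine_imp_affine,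
rc 0). Cheapest test: residuals of R_N against a straight line in N at moderate T (certified
numerics / kit). Sources: AokiKusnezov2001, AokiKusnezov2002, BardosCaflischNicolaenko1986,
CoronGolseSulem1988, decl Literature.Barriers.AtomisticToContinuum.HasBoundedResponse. -/
@[route_item "route-AtomisticToContinuum-SpatialSlowManifold"]
def ExpAffineResistance : Prop :=
  ∀ ω₂ lam β γ : ℝ, 0 < ω₂ → 0 < lam → 0 < β → 0 < γ → (∀ (N : ℕ) (T_L T_R : ℝ), 0 < T_L → 0 < T_R → ∀ μ ν : MeasureTheory.Measure (Literature.MathematicalPhysics.KineticTheory.HeatConduction.PhaseSpace N), (Literature.MathematicalPhysics.KineticTheory.HeatConduction.pinnedChain ω₂ lam β γ).IsSteadyState N T_L T_R μ → (Literature.MathematicalPhysics.KineticTheory.HeatConduction.pinnedChain ω₂ lam β γ).IsSteadyState N T_L T_R ν → μ = ν) → ∀ T : ℝ, 0 < T → ∃ r : ℝ, 0 < r ∧ ∃ c θ C : ℝ, 0 ≤ θ ∧ θ < 1 ∧ ∀ μ : (N : ℕ) → ℝ → ℝ → MeasureTheory.Measure (Literature.MathematicalPhysics.KineticTheory.HeatConduction.PhaseSpace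 N), (∀ (N : ℕ) (T_L T_R : ℝ), 0 < T_L → 0 < T_R → (Literature.MathematicalPhysics.KineticTheory.HeatConduction.pinnedChain ω₂ lam β γ).IsSteadyState N T_L T_R (μ N T_L T_R)) → ∀ D : ℕ → ℝ, (∀ N : ℕ, Filter.Tendsto (fun δ : ℝ => (Literature.MathematicalPhysics.KineticTheory.HeatConduction.pinnedChain ω₂ lam β γ).totalCurrent (μ N (T + δ / 2) (T - δ / 2)) / δ) (nhdsWithin 0 {(0 : ℝ)}ᶜ) (nhds (D N))) → ∀ N : ℕ, |((N : ℝ) - 1) / D N - ((N : ℝ) - 1) * r - c| ≤ C * θ ^ N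

/-- item stmt-AtomisticToContinuum-3478 · crux · rank 5 · closed · moot by None · by planner
why it might fail: Even if D_N→κ∈(0,∞) (open!), a bounded contact correction can fail: slowly relaxing boundary layers give log N or N^α terms (FPU-β boundary jumps scale anomalously); κ=∞ (hidden odd charge, Mazur) or κ=0 kills r>0; no N-uniform bound of any kind is known (HasBoundedResponse).
sources: BonettoLebowitzReyBellet2000 §5.3 (33), §6.3 ('nothing is known about the dependence of D on L'), AokiKusnezov2001, Dhar2008 (arXiv:0808.3256) §9, decl Literature.Barriers.AtomisticToContinuum.HasBoundedResponse (hasBoundedResponse_of_fouriersLawFor), decl Literature.Barriers.AtomisticToContinuum.Mazur1969_inequality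
[crux] AFFINE RESISTANCE LAW (bounded contact correction) — the assembly's input. For pinnedChain
(all > 0), weak-NESS uniqueness, T > 0: ∃ r > 0, C such that for every steady-state family μ, every
D with D_N = lim_{δ→0,δ≠0} totalCurrent(μ_{N,T+δ/2,T−δ/2})/δ for all N, and every N: |(N−1)/D_N −
(N−1)r| ≤ C. Equivalently R_N = (N−1)r + O(1): Fourier's law WITH the finite-size rate D_N = κ +
O(1/N), κ(T) = 1/r(T) — strictly stronger than clause (ii) of FouriersLawFor (no rate there). r, C
are fixed before the family (under uniqueness the family is unique where it matters). N = 0, 1: D_N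
= 0 and the term is (N−1)r. Implied by LocalFourierLaw + BathFluxBalance (item
LocalLawToResistance), by ExpAffineResistance and by BathIndependentResistivity — any of the three
closes it. Assembly use: with NessUnique and FiniteResponseOfUnique, κ T := 1/r(T); |1/D_N − r| ≤
C/(N−1) forces D_N ≠ 0 eventually and D_N → 1/r. Sources: BonettoLebowitzReyBellet2000 §5.3 (33),
§6.3; AokiKusnezov2001; Dhar2008 §9; decl
Literature.Barriers.AtomisticToContinuum.HasBoundedResponse. -/
@[route_item "route-AtomisticToContinuum-SpatialSlowManifold"]
def AffineResistanceLaw : Prop :=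
  ∀ ω₂ lam β γ : ℝ, 0 < ω₂ → 0 < lam → 0 < β → 0 < γ → (∀ (N : ℕ) (T_L T_R : ℝ), 0 < T_L → 0 < T_R → ∀ μ ν : MeasureTheory.Measure (Literature.MathematicalPhysics.KineticTheory.HeatConduction.PhaseSpace N), (Literature.MathematicalPhysics.KineticTheory.HeatConduction.pinnedChain ω₂ lam β γ).IsSteadyState N T_L T_R μ → (Literature.MathematicalPhysics.KineticTheory.HeatConduction.pinnedChain ω₂ lam β γ).IsSteadyState N T_L T_R ν → μ = ν) → ∀ T : ℝ, 0 < T → ∃ r : ℝ, 0 < r ∧ ∃ C : ℝ, ∀ μ : (N : ℕ) → ℝ → ℝ → MeasureTheory.Measure (Literature.MathematicalPhysics.KineticTheory.HeatConduction.PhaseSpace N), (∀ (N : ℕ) (T_L T_R : ℝ), 0 < T_L → 0 < T_R → (Literature.MathematicalPhysics.KineticTheory.HeatConduction.pinnedChain ω₂ lam β γ).IsSteadyState N T_L T_R (μ N T_L T_R)) → ∀ D : ℕ → ℝ, (∀ N : ℕ, Filter.Tendsto (fun δ : ℝ => (Literature.MathematicalPhysics.KineticTheory.HeatConduction.pinnedChain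 ω₂ lam β γ).totalCurrent (μ N (T + δ / 2) (T - δ / 2)) / δ) (nhdsWithin 0 {(0 : ℝ)}ᶜ) (nhds (D N))) → ∀ N : ℕ, |((N : ℝ) - 1) / D N - ((N : ℝ) - 1) * r| ≤ C

/-- item stmt-AtomisticToContinuum-0717 · support · rank 9 · closed · proved by Summit.AtomisticToContinuum.FouriersLaw.Theorems.FourierGreenKubo.finiteResponseOfUnique_holds (prover) · by planner
sources: HairerMajda2009 (arXiv:0909.4313) Thm 2.3, ReyBellet2003 Rem 4.4 (56), route FourierGreenKubo item stmt-AtomisticToContinuum-0717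
CONDITIONAL FORM OF 0705 (supersedes it as the prover target; refuters pool-5/g3-0: 0705 stand-alone
quantifies over EVERY steady-state family and is false-prone if weak steady states were non-unique):
assuming UNIQUENESS of weak steady states (IsSteadyState class) for pinnedChain at all N, T_L, T_R >
0, the finite-N linear-response limit D_N(T) = lim_{δ→0, δ≠0} totalCurrent(μ_{N,T+δ/2,T−δ/2})/δ
exists for every T > 0 and N. Content: differentiability at equilibrium of NESS expectations of the
polynomial currents in the bath temperatures (ReyBellet2003 arXiv:math-ph/0303021 Rem 4.4 (51)–(56)
finite-volume Green–Kubo; HairerMajda2009 arXiv:0909.4313 Thm 2.3 framework — their SDE Thm 4.4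
Assumption 5 fails here, so verify Assumptions 1–3 via CEHR2018 (2.5)/Carmona2007 Thm 1.1(iv)
weighted spectral gap). N = 0, 1: totalCurrent ≡ 0, D = 0. Together with 0706 gives 0705. -/
@[route_item "route-AtomisticToContinuum-SpatialSlowManifold"]
def FiniteResponseOfUnique : Prop :=
  ∀ ω₂ lam β γ : ℝ, 0 < ω₂ → 0 < lam → 0 < β → 0 < γ → (∀ (N : ℕ) (T_L T_R : ℝ), 0 < T_L → 0 < T_R → ∀ μ ν : MeasureTheory.Measure (Literature.MathematicalPhysics.KineticTheory.HeatConduction.PhaseSpace N), (Literature.MathematicalPhysics.KineticTheory.HeatConduction.pinnedChain ω₂ lam β γ).IsSteadyState N T_L T_R μ → (Literature.MathematicalPhysics.KineticTheory.HeatConduction.pinnedChain ω₂ lam β γ).IsSteadyState N T_L T_R ν → μ = ν) → ∀ μ : (N : ℕ) → ℝ → ℝ → MeasureTheory.Measure (Literature.MathematicalPhysics.KineticTheory.HeatConduction.PhaseSpace N), (∀ (N : ℕ) (T_L T_R : ℝ), 0 < T_L → 0 < T_R → (Literature.MathematicalPhysics.KineticTheory.HeatConduction.pinnedChain ω₂ lam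 β γ).IsSteadyState N T_L T_R (μ N T_L T_R)) → ∀ T : ℝ, 0 < T → ∀ N : ℕ, ∃ D : ℝ, Filter.Tendsto (fun δ : ℝ => (Literature.MathematicalPhysics.KineticTheory.HeatConduction.pinnedChain ω₂ lam β γ).totalCurrent (μ N (T + δ / 2) (T - δ / 2)) / δ) (nhdsWithin 0 {(0 : ℝ)}ᶜ) (nhds D)

/-- `FiniteResponseOfUnique` holds: proved by `Summit.AtomisticToContinuum.FouriersLaw.Theorems.FourierGreenKubo.finiteResponseOfUnique_holds`. -/
theorem FiniteResponseOfUnique_holds : FiniteResponseOfUnique := _root_.Summit.AtomisticToContinuum.FouriersLaw.Theorems.FourierGreenKubo.finiteResponseOfUnique_holds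

/-- item stmt-AtomisticToContinuum-0741 · support · rank 9 · closed · proved by Summit.AtomisticToContinuum.FouriersLaw.Theorems.nessUnique_proof (prover) · by planner
sources: CuneoEckmannHairerReyBellet2018 Thm 2.13(1), Carmona2007 Thm 1.1(iii), route FourierGreenKubo item stmt-AtomisticToContinuum-0741
[crux] UNIQUENESS OF THE WEAK STEADY STATE (the half of stmt-0706 not covered by the landed fact
Literature.MathematicalPhysics.KineticTheory.HeatConduction.CuneoEckmannHairerReyBellet2018_pinnedChain,
p3544): for pinnedChain ω₂ lam β γ (all > 0), every N and T_L, T_R > 0, any two measures in the weak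
Fokker–Planck class IsSteadyState (probability, ∫ L f dμ = 0 for f ∈ C_c^∞, bond currents
integrable) coincide. Print: uniqueness of the INVARIANT MEASURE of the Langevin semigroup
(CuneoEckmannHairerReyBellet2018 Thm 2.13(1): C1, C2, CA; Carmona2007 Thm 1.1(iii)); the item
additionally needs 'weak stationary probability solution of L*μ = 0 ⇒ P_t-invariant' for this
hypoelliptic L with cubic drift (Echeverría 1982 well-posed martingale problem on C_c^∞ +
non-explosion via e^{θH}; Bogachev–Krylov–Röckner–Shaposhnikov 2015 Ch. 5 is non-degenerate only) —
the FP-identification lemma is the formal crux. N = 0: PhaseSpace 0 is a point (unique probability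
measure); N = 1: both baths on site 0, OU at temperature (T_L+T_R)/2. This is exactly the hypothesis
of FiniteResponse and ThermodynamicLimit and, with the fact, gives clause (i) of FouriersLawFor. -/
@[route_item "route-AtomisticToContinuum-SpatialSlowManifold"]
def NessUnique : Prop :=
  ∀ ω₂ lam β γ : ℝ, 0 < ω₂ → 0 < lam → 0 < β → 0 < γ → ∀ (N : ℕ) (T_L T_R : ℝ), 0 < T_L → 0 < T_R → ∀ μ ν : MeasureTheory.Measure (Literature.MathematicalPhysics.KineticTheory.HeatConduction.PhaseSpace N), (Literature.MathematicalPhysics.KineticTheory.HeatConduction.pinnedChain ω₂ lam β γ).IsSteadyState N T_L T_R μ → (Literature.MathematicalPhysics.KineticTheory.HeatConduction.pinnedChain ω₂ lam β γ).IsSteadyState N T_L T_R ν → μ = ν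

/-- `NessUnique` holds: proved by `Summit.AtomisticToContinuum.FouriersLaw.Theorems.nessUnique_proof`. -/
theorem NessUnique_holds : NessUnique := _root_.Summit.AtomisticToContinuum.FouriersLaw.Theorems.nessUnique_proof

/-- item stmt-AtomisticToContinuum-3479 · support · rank 9 · closed · moot by None · by planner
sources: BonettoLebowitzReyBellet2000 §4.1 (10), §5.2 (23)-(27), CuneoEckmannHairerReyBellet2018 Thm 2.13, decl Literature.MathematicalPhysics.KineticTheory.HeatConduction.CuneoEckmannHairerReyBellet2018_pinnedChain_holds
[support] BATH FLUX BALANCE (provable now). For pinnedChain (all > 0), assuming weak-NESS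
uniqueness: every weak steady state μ (IsSteadyState N T_L T_R, T_L, T_R > 0) has finite second
moments of the momenta; all bond currents have the same mean (∫ j_i dμ = ∫ j_j dμ for i+1, j+1 < N);
and the boundary energy balances hold: ∫ j_0 dμ = γ(T_L − ∫ p_0² dμ) (N ≥ 2) and ∫ j_{N−2} dμ = γ(∫
p_{N−1}² dμ − T_R). Proof route: by uniqueness μ is the CEHR state
(Literature.MathematicalPhysics.KineticTheory.HeatConduction.CuneoEckmannHairerReyBellet2018_pinnedChain_holds,
PROVED: e^{ϑH} ∈ L¹(μ) for ϑ < 1/max(T_L,T_R)), so polynomial observables are integrable; extend ∫ L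
f dμ = 0 from C_c^∞ to polynomially bounded smooth f with cutoffs χ(H/R) (H is smooth and proper
since ω₂ > 0; L(fχ_R) = χ_R Lf + f Lχ_R + 2γ(T_L ∂_{p_0}f ∂_{p_0}χ_R + T_R ∂_{p_{N−1}}f
∂_{p_{N−1}}χ_R); dominated convergence); then L(p_0²/2 + U(q_0)) = p_0 V′(q_1 − q_0) + γ(T_L −
p_0²), L V(q_1 − q_0) = (p_1 − p_0)V′(q_1 − q_0) and j_0 = −½(p_0 + p_1)V′(q_1 − q_0) give the left
identity; interior site energies p_i²/2 + U(q_i) give ∫ j_{i−1} dμ = ∫ j_i dμ; the right end is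
symmetric. partialP/partialQ are one-variable derivs alon -/
@[route_item "route-AtomisticToContinuum-SpatialSlowManifold"]
def BathFluxBalance : Prop :=
  ∀ ω₂ lam β γ : ℝ, 0 < ω₂ → 0 < lam → 0 < β → 0 < γ → (∀ (N : ℕ) (T_L T_R : ℝ), 0 < T_L → 0 < T_R → ∀ μ ν : MeasureTheory.Measure (Literature.MathematicalPhysics.KineticTheory.HeatConduction.PhaseSpace N), (Literature.MathematicalPhysics.KineticTheory.HeatConduction.pinnedChain ω₂ lam β γ).IsSteadyState N T_L T_R μ → (Literature.MathematicalPhysics.KineticTheory.HeatConduction.pinnedChain ω₂ lam β γ).IsSteadyState N T_L T_R ν → μ = ν) → ∀ (N : ℕ) (T_L T_R : ℝ), 0 < T_L → 0 < T_R → ∀ μ : MeasureTheory.Measure (Literature.MathematicalPhysics.KineticTheory.HeatConduction.PhaseSpace N), (Literature.MathematicalPhysics.KineticTheory.HeatConduction.pinnedChain ω₂ lam β γ).IsSteadyState N T_L T_R μ → (∀ i : Fin N, MeasureTheory.Integrable (fun x : Literature.MathematicalPhysics.KineticTheory.HeatConduction.PhaseSpace N => (x.2 i) ^ 2) μ) ∧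 (∀ i j : Fin N, i.val + 1 < N → j.val + 1 < N → ∫ x, (Literature.MathematicalPhysics.KineticTheory.HeatConduction.pinnedChain ω₂ lam β γ).bondCurrent N i x ∂μ = ∫ x, (Literature.MathematicalPhysics.KineticTheory.HeatConduction.pinnedChain ω₂ lam β γ).bondCurrent N j x ∂μ) ∧ (∀ i : Fin N, i.val = 0 → i.val + 1 < N → ∫ x, (Literature.MathematicalPhysics.KineticTheory.HeatConduction.pinnedChain ω₂ lam β γ).bondCurrent N i x ∂μ = γ * (T_L - ∫ x, (x.2 i) ^ 2 ∂μ)) ∧ (∀ i j : Fin N, j.val = i.val + 1 → j.val + 1 = N → ∫ x, (Literature.MathematicalPhysics.KineticTheory.HeatConduction.pinnedChain ω₂ lam β γ).bondCurrent N i x ∂μ = γ * ((∫ x, (x.2 j) ^ 2 ∂μ) - T_R))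

/-- item stmt-AtomisticToContinuum-3480 · support · rank 10 · closed · moot by None · by planner
sources: folklore (telescoping + bath relations), planner sketch Sketch.lean (shape checks rc 0)
[support] GLUE (provable now, pure real analysis): LocalFourierLaw → BathFluxBalance →
AffineResistanceLaw, the three statements expanded verbatim (items LocalFourierLaw, BathFluxBalance,
AffineResistanceLaw of this route). Proof: fix parameters, uniqueness, T > 0; take r, θ, C from
LocalFourierLaw; given a family μ and N ≥ 2, BathFluxBalance at (T+δ/2, T−δ/2) (valid for |δ| < 2T,
enough for limits along 𝓝[≠] 0) gives equal bond currents, so totalCurrent = (N−1)∫ j_0 (the last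
Fin-index carries bondCurrent = 0), and ∫ j_0/δ = γ(1/2 − (∫p_0² − T)/δ) → γ(1/2 − τ_0), ∫ j_{N−2}/δ
→ γ(τ_{N−1} + 1/2); uniqueness of limits (𝓝[≠] 0 is NeBot) gives ι = γ(1/2 − τ_0) = γ(τ_{N−1} + 1/2)
and D_N = (N−1)ι. Telescoping the local law over the N−1 bonds: |τ_{N−1} − τ_0 + (N−1)rι| ≤
C|ι|Σ_i(θ^i + θ^{N−2−i}) ≤ 2C|ι|/(1−θ), i.e. |(N−1)rι + 2ι/γ − 1| ≤ 2C|ι|/(1−θ); ι = 0 is impossible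
(|−1| ≤ 0), so dividing by |ι|: |1/ι − (N−1)r| ≤ 2C/(1−θ) + 2/γ, and (N−1)/D_N = 1/ι. N = 0, 1:
totalCurrent ≡ 0 so D_N = 0 and the term is |(N−1)r| ≤ r. Hence C_A := max(2C/(1−θ) + 2/γ, r).
De-risks the typed shapes of the two cruxes now; a mismatch found here means a restate, not a
refutation. -/
@[route_item "route-AtomisticToContinuum-SpatialSlowManifold"]
def LocalLawToResistance : Prop :=
  (∀ ω₂ lam β γ : ℝ, 0 < ω₂ → 0 < lam → 0 < β → 0 < γ → (∀ (N : ℕ) (T_L T_R : ℝ), 0 < T_L → 0 < T_R → ∀ μ ν : MeasureTheory.Measure (Literature.MathematicalPhysics.KineticTheory.HeatConduction.PhaseSpace N), (Literature.MathematicalPhysics.KineticTheory.HeatConduction.pinnedChain ω₂ lam β γ).IsSteadyState N T_L T_R μ → (Literature.MathematicalPhysics.KineticTheory.HeatConduction.pinnedChain ω₂ lam β γ).IsSteadyState N T_L T_R ν → μ = ν) → ∀ T : ℝ, 0 < T → ∃ r : ℝ, 0 < r ∧ ∃ θ C : ℝ, 0 ≤ θ ∧ θ < 1 ∧ ∀ μ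 : (N : ℕ) → ℝ → ℝ → MeasureTheory.Measure (Literature.MathematicalPhysics.KineticTheory.HeatConduction.PhaseSpace N), (∀ (N : ℕ) (T_L T_R : ℝ), 0 < T_L → 0 < T_R → (Literature.MathematicalPhysics.KineticTheory.HeatConduction.pinnedChain ω₂ lam β γ).IsSteadyState N T_L T_R (μ N T_L T_R)) → ∀ N : ℕ, ∃ ι : ℝ, ∃ τ : Fin N → ℝ, Filter.Tendsto (fun δ : ℝ => (Literature.MathematicalPhysics.KineticTheory.HeatConduction.pinnedChain ω₂ lam β γ).totalCurrent (μ N (T + δ / 2) (T - δ / 2)) / δ) (nhdsWithin 0 {(0 : ℝ)}ᶜ) (nhds (((N : ℝ) - 1) * ι)) ∧ (∀ i : Fin N, Filter.Tendsto (fun δ : ℝ => ((∫ x, (x.2 i) ^ 2 ∂(μ N (T + δ / 2) (T - δ / 2))) - T) / δ) (nhdsWithin 0 {(0 : ℝ)}ᶜ) (nhds (τ i))) ∧ ∀ i j : Fin N, j.val = i.val + 1 → |τ j - τ i + r * ι| ≤ C * |ι| * (θ ^ i.val + θ ^ (N - 1 - j.val))) → (∀ ω₂ lam β γ : ℝ,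 0 < ω₂ → 0 < lam → 0 < β → 0 < γ → (∀ (N : ℕ) (T_L T_R : ℝ), 0 < T_L → 0 < T_R → ∀ μ ν : MeasureTheory.Measure (Literature.MathematicalPhysics.KineticTheory.HeatConduction.PhaseSpace N), (Literature.MathematicalPhysics.KineticTheory.HeatConduction.pinnedChain ω₂ lam β γ).IsSteadyState N T_L T_R μ → (Literature.MathematicalPhysics.KineticTheory.HeatConduction.pinnedChain ω₂ lam β γ).IsSteadyState N T_L T_R ν → μ = ν) → ∀ (N : ℕ) (T_L T_R : ℝ), 0 < T_L → 0 < T_R → ∀ μ : MeasureTheory.Measure (Literature.MathematicalPhysics.KineticTheory.HeatConduction.PhaseSpace N), (Literature.MathematicalPhysics.KineticTheory.HeatConduction.pinnedChain ω₂ lam β γ).IsSteadyState N T_L T_R μ → (∀ i : Fin N, MeasureTheory.Integrable (fun x : Literature.MathematicalPhysics.KineticTheory.HeatConduction.PhaseSpace N => (x.2 i) ^ 2) μ) ∧ (∀ i j : Fin N, i.val + 1 < N → j.val + 1 < N → ∫ x, (Literature.MathematicalPhysics.KineticTheory.HeatConduction.pinnedChain ω₂ lam β γ).bondCurrent N i x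 ∂μ = ∫ x, (Literature.MathematicalPhysics.KineticTheory.HeatConduction.pinnedChain ω₂ lam β γ).bondCurrent N j x ∂μ) ∧ (∀ i : Fin N, i.val = 0 → i.val + 1 < N → ∫ x, (Literature.MathematicalPhysics.KineticTheory.HeatConduction.pinnedChain ω₂ lam β γ).bondCurrent N i x ∂μ = γ * (T_L - ∫ x, (x.2 i) ^ 2 ∂μ)) ∧ (∀ i j : Fin N, j.val = i.val + 1 → j.val + 1 = N → ∫ x, (Literature.MathematicalPhysics.KineticTheory.HeatConduction.pinnedChain ω₂ lam β γ).bondCurrent N i x ∂μ = γ * ((∫ x, (x.2 j) ^ 2 ∂μ) - T_R))) → (∀ ω₂ lam β γ : ℝ, 0 < ω₂ → 0 < lam → 0 < β → 0 < γ → (∀ (N : ℕ) (T_L T_R : ℝ), 0 < T_L → 0 < T_R → ∀ μ ν : MeasureTheory.Measure (Literature.MathematicalPhysics.KineticTheory.HeatConduction.PhaseSpace N), (Literature.MathematicalPhysics.KineticTheory.HeatConduction.pinnedChain ω₂ lam β γ).IsSteadyState N T_L T_R μ → (Literature.MathematicalPhysics.KineticTheory.HeatConduction.pinnedChain ω₂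 lam β γ).IsSteadyState N T_L T_R ν → μ = ν) → ∀ T : ℝ, 0 < T → ∃ r : ℝ, 0 < r ∧ ∃ C : ℝ, ∀ μ : (N : ℕ) → ℝ → ℝ → MeasureTheory.Measure (Literature.MathematicalPhysics.KineticTheory.HeatConduction.PhaseSpace N), (∀ (N : ℕ) (T_L T_R : ℝ), 0 < T_L → 0 < T_R → (Literature.MathematicalPhysics.KineticTheory.HeatConduction.pinnedChain ω₂ lam β γ).IsSteadyState N T_L T_R (μ N T_L T_R)) → ∀ D : ℕ → ℝ, (∀ N : ℕ, Filter.Tendsto (fun δ : ℝ => (Literature.MathematicalPhysics.KineticTheory.HeatConduction.pinnedChain ω₂ lam β γ).totalCurrent (μ N (T + δ / 2) (T - δ / 2)) / δ) (nhdsWithin 0 {(0 : ℝ)}ᶜ) (nhds (D N))) → ∀ N : ℕ, |((N : ℝ) - 1) / D N - ((N : ℝ) - 1) * r| ≤ C)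

/-- item stmt-AtomisticToContinuum-3481 · assembly · rank 1 · closed · moot by None · by planner
sources: planner sketch: `example : Assembly = (NessUnique → FiniteResponseOfUnique → AffineResistanceLaw → FouriersLaw) := rfl` rc 0
[assembly] NessUnique → FiniteResponseOfUnique → AffineResistanceLaw →
Literature.MathematicalPhysics.KineticTheory.HeatConduction.FouriersLaw (expanded terms;
definitionally the curried form over the three items, checked by rfl in the planner sketch). Glue
(~80 lines): fix ω₂ lam β γ > 0; clause (i): existence from
Literature.MathematicalPhysics.KineticTheory.HeatConduction.CuneoEckmannHairerReyBellet2018_pinnedChain_holds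
(N ≥ 1; import Literature.MathematicalPhysics.KineticTheory.LangevinChainNESSHolds) and
OscillatorChain.isSteadyState_zero (N = 0), uniqueness from NessUnique (convert μ = ν to the ∃ μ, …
∀ ν, ν = μ form); clause (ii): κ T := 1/r(T) with r = Classical.choose (AffineResistanceLaw … huniq
T hT) for T > 0 (κ T := 1 otherwise), κ T > 0; for a family μ and T > 0 put D N := Classical.choose
(FiniteResponseOfUnique … N); from |(N−1)/D_N − (N−1)r| ≤ C: for (N−1)r > C the quotient is
positive, so D_N ≠ 0 (else the Lean quotient is 0) and |1/D_N − r| ≤ C/(N−1) → 0, hence D_N → 1/r =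
κ T (continuity of inversion at r ≠ 0; Filter.Tendsto.inv₀). No import beyond the Statement is
needed for the STATEMENT; the proof imports LangevinChainNESSHolds. -/
@[route_item "route-AtomisticToContinuum-SpatialSlowManifold"]
def Assembly : Prop :=
  (∀ ω₂ lam β γ : ℝ, 0 < ω₂ → 0 < lam → 0 < β → 0 < γ → ∀ (N : ℕ) (T_L T_R : ℝ), 0 < T_L → 0 < T_R → ∀ μ ν : MeasureTheory.Measure (Literature.MathematicalPhysics.KineticTheory.HeatConduction.PhaseSpace N), (Literature.MathematicalPhysics.KineticTheory.HeatConduction.pinnedChain ω₂ lam β γ).IsSteadyState N T_L T_R μ → (Literature.MathematicalPhysics.KineticTheory.HeatConduction.pinnedChain ω₂ lam β γ).IsSteadyState N T_L T_R ν → μ = ν) → (∀ ω₂ lam β γ : ℝ, 0 < ω₂ → 0 < lam → 0 < β → 0 < γ → (∀ (N : ℕ) (T_L T_R : ℝ), 0 < T_L → 0 < T_R → ∀ μ ν : MeasureTheory.Measure (Literature.MathematicalPhysics.KineticTheory.HeatConduction.PhaseSpace N), (Literature.MathematicalPhysics.KineticTheory.HeatConduction.pinnedChain ω₂ lam β γ).IsSteadyState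 N T_L T_R μ → (Literature.MathematicalPhysics.KineticTheory.HeatConduction.pinnedChain ω₂ lam β γ).IsSteadyState N T_L T_R ν → μ = ν) → ∀ μ : (N : ℕ) → ℝ → ℝ → MeasureTheory.Measure (Literature.MathematicalPhysics.KineticTheory.HeatConduction.PhaseSpace N), (∀ (N : ℕ) (T_L T_R : ℝ), 0 < T_L → 0 < T_R → (Literature.MathematicalPhysics.KineticTheory.HeatConduction.pinnedChain ω₂ lam β γ).IsSteadyState N T_L T_R (μ N T_L T_R)) → ∀ T : ℝ, 0 < T → ∀ N : ℕ, ∃ D : ℝ, Filter.Tendsto (fun δ : ℝ => (Literature.MathematicalPhysics.KineticTheory.HeatConduction.pinnedChain ω₂ lam β γ).totalCurrent (μ N (T + δ / 2) (T - δ / 2)) / δ) (nhdsWithin 0 {(0 : ℝ)}ᶜ) (nhds D)) → (∀ ω₂ lam β γ : ℝ, 0 < ω₂ → 0 < lam → 0 < β → 0 < γ → (∀ (N : ℕ) (T_L T_R : ℝ), 0 < T_L → 0 < T_R → ∀ μ ν : MeasureTheory.Measure (Literature.MathematicalPhysics.KineticTheory.HeatConduction.PhaseSpace N), (Literature.MathematicalPhysics.KineticTheory.HeatConduction.pinnedChain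 ω₂ lam β γ).IsSteadyState N T_L T_R μ → (Literature.MathematicalPhysics.KineticTheory.HeatConduction.pinnedChain ω₂ lam β γ).IsSteadyState N T_L T_R ν → μ = ν) → ∀ T : ℝ, 0 < T → ∃ r : ℝ, 0 < r ∧ ∃ C : ℝ, ∀ μ : (N : ℕ) → ℝ → ℝ → MeasureTheory.Measure (Literature.MathematicalPhysics.KineticTheory.HeatConduction.PhaseSpace N), (∀ (N : ℕ) (T_L T_R : ℝ), 0 < T_L → 0 < T_R → (Literature.MathematicalPhysics.KineticTheory.HeatConduction.pinnedChain ω₂ lam β γ).IsSteadyState N T_L T_R (μ N T_L T_R)) → ∀ D : ℕ → ℝ, (∀ N : ℕ, Filter.Tendsto (fun δ : ℝ => (Literature.MathematicalPhysics.KineticTheory.HeatConduction.pinnedChain ω₂ lam β γ).totalCurrent (μ N (T + δ / 2) (T - δ / 2)) / δ) (nhdsWithin 0 {(0 : ℝ)}ᶜ) (nhds (D N))) → ∀ N : ℕ, |((N : ℝ) - 1) / D N - ((N : ℝ) - 1) * r| ≤ C) → Literature.MathematicalPhysics.KineticTheory.HeatConduction.FouriersLaw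

end Summit.AtomisticToContinuum.FouriersLaw.Theses.SpatialSlowManifold
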